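import Mathlib
import Summits.NavierStokesRegularity.NavierStokesRegularity.Theorems.StretchingWellBindingEnstrophyQuarterLawSieveCounting
import HarnessLib

/-!
# Shelf crux `EnstrophyQuarterLaw` (stmt-NavierStokesRegularity-1574), line «sparse_sieve»:
# the dyadic ε-regularity sieve on the core (`stub_sieve`, part 4 of 5)

Theorems helper file (seat ns-hhe-c1 g2; `--supports` the shelf crux). The heart of the registered
stub `stub_sieve` of `Cruxes/EnstrophyQuarterLaw/Lines/sparse_sieve.lean`: the theorem
`core_window_bound`. Navier–Stokes regularity is NOT proved by anything here (a bookkeeping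
estimate for a field with HYPOTHESISED local Type-I, smoothing-envelope and sparseness properties).

## The sieve (`core_window_bound`)

Data: `u` jointly smooth on `[0, T) × ℝ³`; the scaled dissipation bound
`∫_{b−R²}^{b} ∫_{B(x,R)} ‖Du‖² ≤ M R` (`R ≤ r₀`, `R² ≤ b ≤ T`); the smoothing envelope with
constants `γ, σ, C` (smallness `∫_{B(x₀,2R)} |u(b − σR²)|³ ≤ γ³` certifies
`∫_{t₁}^{b} ∫_{B(x₀,R/4)} ‖Du‖² ≤ C (b − t₁)/R` for `t₁ ≥ b − σR²/4`); sparseness of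
`γ`-concentration at scales `≤ r₁` with bound `N₀`.
Fix a window `(a, b) ⊆ [T/2, T]` of length `τ ≤ τ₀ = min(σ' R₀²/16, σ' T/2)`, `σ' = min σ 1`,
`R₀ = min(r₀, r₁, √(T/(2σ)))`, and the dyadic scales `R_j = R₀ 2^{-j}`. At level `j` the cubic
lattice of spacing `R_j/4` (points `(R_j/4) k`, `k ∈ ℤ³`) is tested at the restart time
`b − σ R_j² ∈ [0, T)`: `k` is BAD if `∫_{B(x_k, 2R_j)} |u(b − σR_j²)|³ > γ³`. Every finite box has
at most `4096 N₀` bad indices (`card_lattice_filter_le`). The core `B(0, ρ)` is covered by the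
balls `B(x_k, R₀/4)` of the level-`0` box `[-K₀, K₀]³`; a good ball of level `j ≤ J` costs
`C τ / R_j` on the window (certified, since `τ ≤ σ R_J²/4 ≤ σ R_j²/4` by the choice of the stopping
level `J`, `exists_dyadic_level`); a bad ball `B(x_k, R_j/4)` is covered by the balls of its
`≤ 125` children at level `j+1` (`exists_child_lattice`), which stay in the box
`[-K_{j+1}, K_{j+1}]³`, `K_{j+1} = 2K_j + 2`; at the stopping level the `≤ 4096 N₀` bad balls
have radius `R_J/4 ≤ R' = √(τ/σ') ≤ R₀/4` and the window lies in `(b − R'², b)`, so each costs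
`M R'` by the scaled dissipation bound. The slicewise cover bound is integrated in time term by
term (the ball dissipations are a.e.-measurable in `t`, `aemeasurable_setLIntegral_enorm_fderiv_sq`),
and `sieve_arith` adds up: `∫_a^b ∫_{B(0,ρ)} ‖Du‖² ≤ K √τ`,
`K = (n₀ + 512000 N₀) C √σ + 4096 N₀ M/√σ'`, `n₀` the size of the level-`0` box.

Reference for the mechanism: Caffarelli–Kohn–Nirenberg 1982 (ε-regularity) run dyadically per
window — the line card `Cruxes/EnstrophyQuarterLaw/Lines/sparse_sieve.md` (ns-idea-9) as re-done by
idea-crit-8 (verdict 2026-08-28); no published source states this lemma (presearch in the card).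
-/

noncomputable section

-- the summit and its single sub-problem share the name (CONVENTIONS §1), as in every Theorems file
set_option linter.dupNamespace false

namespace Summit.NavierStokesRegularity.NavierStokesRegularity.Theorems.EnstrophyQuarterLaw.SparseSieve

open MeasureTheory Set Metric Finset Filter Topology Function
open Literature.Analysis Literature.Analysis.FluidPDE
open scoped ENNReal NNReal

/-! ### The core estimate: the dyadic sieve on `B(0, ρ) × (a, b)` -/

/-- **Core window bound (the dyadic ε-regularity sieve).** Let `u` be jointly smooth on
`[0, T) × ℝ³` with: the scaled dissipation bound `∫_{b−R²}^{b} ∫_{B(x,R)} ‖Du‖² ≤ M R`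
(`R ≤ r₀`, `R² ≤ b ≤ T`); the smoothing envelope with constants `γ, σ, C` at scales `≤ r₀`;
and sparseness of `γ`-concentration at scales `≤ r₁` with bound `N₀`. Then for every `ρ` there
are `K ≥ 0` and `τ₀ > 0` such that every window `(a, b) ⊆ [T/2, T]` of length `≤ τ₀` has
`∫_a^b ∫_{B(0,ρ)} ‖Du‖² ≤ K √(b − a)`. The proof is the dyadic sieve described in the module
docstring. [folklore] -/
theorem core_window_bound {T : ℝ} {u : ℝ → EuclideanSpace ℝ (Fin 3) → EuclideanSpace ℝ (Fin 3)}
    (hT : 0 < T) (hu : IsSmoothSpaceTimeOn (Ico 0 T) u)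
    {M r₀ : ℝ} (hM : 0 ≤ M) (hr₀ : 0 < r₀)
    (hE : ∀ b ∈ Ioc 0 T, ∀ (x : EuclideanSpace ℝ (Fin 3)), ∀ R ∈ Ioc 0 r₀, R ^ 2 ≤ b →
      ∫⁻ t in Ioo (b - R ^ 2) b, ∫⁻ y in ball x R, ‖fderiv ℝ (u t) y‖ₑ ^ 2 ≤
        ENNReal.ofReal (M * R))
    {γ σ C : ℝ} (hσ : 0 < σ) (hC : 0 ≤ C)
    (hS : ∀ (b R : ℝ) (x₀ : EuclideanSpace ℝ (Fin 3)), 0 < R → R ≤ r₀ → 0 ≤ b - σ * R ^ 2 →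
      b ≤ T → ∫⁻ y in ball x₀ (2 * R), ‖u (b - σ * R ^ 2) y‖ₑ ^ 3 ≤ ENNReal.ofReal (γ ^ 3) →
      ∀ t₁ ∈ Ico (b - σ * R ^ 2 / 4) b,
        ∫⁻ t in Ioo t₁ b, ∫⁻ y in ball x₀ (R / 4), ‖fderiv ℝ (u t) y‖ₑ ^ 2 ≤
          ENNReal.ofReal (C * (b - t₁) / R))
    {r₁ : ℝ} {N₀ : ℕ} (hr₁ : 0 < r₁)
    (hN : ∀ t ∈ Ico 0 T, ∀ r ∈ Ioc 0 r₁, ∀ F : Finset (EuclideanSpace ℝ (Fin 3)),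
      (∀ x ∈ F, ∀ y ∈ F, x ≠ y → 4 * r ≤ dist x y) →
      (∀ x ∈ F, ENNReal.ofReal (γ ^ 3) ≤ ∫⁻ y in ball x (2 * r), ‖u t y‖ₑ ^ 3) → F.card ≤ N₀)
    (ρ : ℝ) :
    ∃ K τ₀ : ℝ, 0 ≤ K ∧ 0 < τ₀ ∧ ∀ a b : ℝ, T / 2 ≤ a → a < b → b ≤ T → b - a ≤ τ₀ →
      ∫⁻ t in Ioo a b, ∫⁻ x in ball (0 : EuclideanSpace ℝ (Fin 3)) ρ, ‖fderiv ℝ (u t) x‖ₑ ^ 2 ≤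
        ENNReal.ofReal (K * Real.sqrt (b - a)) := by
  classical
  -- ### constants
  set σ' : ℝ := min σ 1 with hσ'def
  have hσ'pos : 0 < σ' := lt_min hσ one_pos
  have hσ'σ : σ' ≤ σ := min_le_left _ _
  have hσ'1 : σ' ≤ 1 := min_le_right _ _
  set R₀ : ℝ := min (min r₀ r₁) (Real.sqrt (T / (2 * σ))) with hR₀def
  have hR₀pos : 0 < R₀ := lt_min (lt_min hr₀ hr₁) (Real.sqrt_pos.2 (by positivity))
  have hR₀r₀ : R₀ ≤ r₀ := (min_le_left _ _).trans (min_le_left _ _)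
  have hR₀r₁ : R₀ ≤ r₁ := (min_le_left _ _).trans (min_le_right _ _)
  have hσR₀ : σ * R₀ ^ 2 ≤ T / 2 := by
    have h1 : R₀ ≤ Real.sqrt (T / (2 * σ)) := min_le_right _ _
    have h2 : R₀ ^ 2 ≤ T / (2 * σ) := by
      calc R₀ ^ 2 ≤ (Real.sqrt (T / (2 * σ))) ^ 2 := pow_le_pow_left₀ hR₀pos.le h1 2
        _ = T / (2 * σ) := Real.sq_sqrt (by positivity)
    calc σ * R₀ ^ 2 ≤ σ * (T / (2 * σ)) := mul_le_mul_of_nonneg_left h2 hσ.le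
      _ = T / 2 := by field_simp
  set τ₀ : ℝ := min (σ' * R₀ ^ 2 / 16) (σ' * T / 2) with hτ₀def
  have hτ₀pos : 0 < τ₀ := lt_min (by positivity) (by positivity)
  have hτ₀a : τ₀ ≤ σ' * R₀ ^ 2 / 16 := min_le_left _ _
  have hτ₀b : τ₀ ≤ σ' * T / 2 := min_le_right _ _
  -- dyadic scales
  set R : ℕ → ℝ := fun j => R₀ / 2 ^ j with hRdef
  have hRpos : ∀ j, 0 < R j := fun j => by positivity
  have hRsucc : ∀ j, R (j + 1) = R j / 2 := fun j => by
    show R₀ / 2 ^ (j + 1) = R₀ / 2 ^ j / 2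
    rw [pow_succ, div_div]
  have hRmono : ∀ {i j : ℕ}, i ≤ j → R j ≤ R i := fun {i j} hij =>
    div_le_div_of_nonneg_left hR₀pos.le (by positivity) (pow_le_pow_right₀ (by norm_num) hij)
  have hRle : ∀ j, R j ≤ R₀ := fun j => by
    have := hRmono (Nat.zero_le j)
    simpa [R] using this
  -- boxes of indices
  set K₀ : ℕ := ⌈ρ / (R 0 / 4)⌉₊ + 1 with hK₀def
  set Kb : ℕ → ℤ := fun j => 2 ^ j * ((K₀ : ℤ) + 2) - 2 with hKbdef
  have hKb0 : Kb 0 = K₀ := by simp [Kb]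
  have hKbsucc : ∀ j, Kb (j + 1) = 2 * Kb j + 2 := fun j => by simp only [Kb]; ring
  set Box : ℕ → Finset (Fin 3 → ℤ) := fun j =>
    Fintype.piFinset fun _ : Fin 3 => Finset.Icc (-Kb j) (Kb j) with hBoxdef
  set n₀ : ℕ := (Box 0).card with hn₀def
  set nstar : ℝ := (n₀ : ℝ) + 512000 * N₀ with hnstardef
  have hnstar0 : 0 ≤ nstar := by positivity
  set K : ℝ := nstar * C * Real.sqrt σ + 4096 * N₀ * M / Real.sqrt σ' with hKdef
  have hK0 : 0 ≤ K := by positivity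
  refine ⟨K, τ₀, hK0, hτ₀pos, fun a b ha hab hb hτ => ?_⟩
  -- ### the window
  have hτpos : 0 < b - a := sub_pos.2 hab
  have hb2 : T / 2 < b := lt_of_le_of_lt ha hab
  have hbpos : 0 < b := lt_trans (by positivity) hb2
  have ha0 : 0 ≤ a := le_trans (by positivity) ha
  -- stopping level
  have hτσ : b - a ≤ σ * R₀ ^ 2 / 4 := by
    have h1 : σ' * R₀ ^ 2 ≤ σ * R₀ ^ 2 := mul_le_mul_of_nonneg_right hσ'σ (sq_nonneg _)
    have h2 : 0 ≤ σ * R₀ ^ 2 := by positivity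
    linarith only [hτ, hτ₀a, h1, h2]
  obtain ⟨J, hJ1, hJ2⟩ := exists_dyadic_level hR₀pos hσ hτpos hτσ
  have hJ1' : ∀ j, j ≤ J → b - a ≤ σ * R j ^ 2 / 4 := fun j hj => by
    have h1 : R J ≤ R j := hRmono hj
    have h2 : σ * R J ^ 2 / 4 ≤ σ * R j ^ 2 / 4 :=
      div_le_div_of_nonneg_right (mul_le_mul_of_nonneg_left
        (pow_le_pow_left₀ (hRpos J).le h1 2) hσ.le) (by norm_num)
    exact le_trans hJ1 h2
  -- restart times are inside `[0, T)`
  have hrestart : ∀ j, b - σ * R j ^ 2 ∈ Ico 0 T := fun j => by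
    constructor
    · have h1 : σ * R j ^ 2 ≤ σ * R₀ ^ 2 :=
        mul_le_mul_of_nonneg_left (pow_le_pow_left₀ (hRpos j).le (hRle j) 2) hσ.le
      linarith only [h1, hσR₀, hb2, hT]
    · have h1 : 0 < σ * R j ^ 2 := by positivity
      linarith only [h1, hb]
  -- lattice points, bad predicate, the finite sets of the sieve
  set pt : ℕ → (Fin 3 → ℤ) → EuclideanSpace ℝ (Fin 3) := fun j k =>
    WithLp.toLp 2 fun i => R j / 4 * (k i : ℝ) with hptdef
  set bad : ℕ → (Fin 3 → ℤ) → Prop := fun j k =>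
    ¬ (∫⁻ y in ball (pt j k) (2 * R j), ‖u (b - σ * R j ^ 2) y‖ₑ ^ 3 ≤ ENNReal.ofReal (γ ^ 3))
    with hbaddef
  set BadSet : ℕ → Finset (Fin 3 → ℤ) := fun j => (Box j).filter (bad j) with hBadSetdef
  set children : (Fin 3 → ℤ) → Finset (Fin 3 → ℤ) := fun k' =>
    (Fintype.piFinset fun _ : Fin 3 => Finset.Icc (-2 : ℤ) 2).image
      (fun d : Fin 3 → ℤ => fun i => 2 * k' i + d i) with hchildrendef
  set Next : ℕ → Finset (Fin 3 → ℤ) := fun j =>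
    ((BadSet j).biUnion children).filter (fun k => ¬ bad (j + 1) k) with hNextdef
  set Good0 : Finset (Fin 3 → ℤ) := (Box 0).filter (fun k => ¬ bad 0 k) with hGood0def
  -- ### counting: at most `4096 N₀` bad indices per level
  have hcardBad : ∀ j, (BadSet j).card ≤ 4096 * N₀ := fun j => by
    refine card_lattice_filter_le (hRpos j)
      (hN (b - σ * R j ^ 2) (hrestart j) (R j) ⟨hRpos j, (hRle j).trans hR₀r₁⟩) (BadSet j) ?_
    intro k hk
    have hbk : bad j k := (Finset.mem_filter.1 hk).2
    exact (not_le.1 hbk).le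
  -- ### the cover of the core by certified balls and the bad balls of the last level
  have hcover : ∀ n : ℕ, ball (0 : EuclideanSpace ℝ (Fin 3)) ρ ⊆
      ((⋃ k ∈ Good0, ball (pt 0 k) (R 0 / 4)) ∪
        ⋃ j ∈ Finset.range n, ⋃ k ∈ Next j, ball (pt (j + 1) k) (R (j + 1) / 4)) ∪
        ⋃ k ∈ BadSet n, ball (pt n k) (R n / 4) := by
    intro n
    induction n with
    | zero =>
      intro y hy
      obtain ⟨k, hk, hdist⟩ := exists_lattice_mem_box (s := R 0 / 4)
        (div_pos (hRpos 0) (by norm_num)) ρ hy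
      have hk0 : k ∈ Box 0 := by
        have e : Box 0 = Fintype.piFinset fun _ : Fin 3 => Finset.Icc (-(K₀ : ℤ)) (K₀ : ℤ) := by
          simp only [Box, hKb0]
        rw [e]; exact hk
      have hyball : y ∈ ball (pt 0 k) (R 0 / 4) := mem_ball.2 hdist
      by_cases hb0 : bad 0 k
      · exact Or.inr (mem_iUnion₂.2 ⟨k, Finset.mem_filter.2 ⟨hk0, hb0⟩, hyball⟩)
      · exact Or.inl (Or.inl (mem_iUnion₂.2 ⟨k, Finset.mem_filter.2 ⟨hk0, hb0⟩, hyball⟩))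
    | succ n ih =>
      intro y hy
      rcases ih hy with (h1 | h2) | h3
      · exact Or.inl (Or.inl h1)
      · obtain ⟨j, hj, hjy⟩ := mem_iUnion₂.1 h2
        refine Or.inl (Or.inr (mem_iUnion₂.2 ⟨j, ?_, hjy⟩))
        exact Finset.mem_range.2 (lt_trans (Finset.mem_range.1 hj) (Nat.lt_succ_self n))
      · obtain ⟨k, hk, hyk⟩ := mem_iUnion₂.1 h3
        have hkBox : k ∈ Box n := (Finset.mem_filter.1 hk).1
        obtain ⟨k', hk'1, hk'2⟩ := exists_child_lattice (s := R (n + 1) / 4) (s' := R n / 4)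
          (div_pos (hRpos (n + 1)) (by norm_num)) (by rw [hRsucc]; ring) k hyk
        have hyball : y ∈ ball (pt (n + 1) k') (R (n + 1) / 4) := mem_ball.2 hk'2
        have hbi : k' ∈ (BadSet n).biUnion children :=
          Finset.mem_biUnion.2 ⟨k, hk, mem_children hk'1⟩
        by_cases hb1 : bad (n + 1) k'
        · have hk'Box : k' ∈ Box (n + 1) := by
            have := child_mem_box (K := Kb n) hkBox hk'1
            have e : Box (n + 1) =
                Fintype.piFinset fun _ : Fin 3 => Finset.Icc (-(2 * Kb n + 2)) (2 * Kb n + 2) := by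
              simp only [Box, hKbsucc]
            rw [e]; exact this
          exact Or.inr (mem_iUnion₂.2 ⟨k', Finset.mem_filter.2 ⟨hk'Box, hb1⟩, hyball⟩)
        · refine Or.inl (Or.inr (mem_iUnion₂.2 ⟨n, Finset.mem_range.2 (Nat.lt_succ_self n), ?_⟩))
          exact mem_iUnion₂.2 ⟨k', Finset.mem_filter.2 ⟨hbi, hb1⟩, hyball⟩
  -- ### slicewise bound by the cover at the stopping level
  set g : ℕ → (Fin 3 → ℤ) → ℝ → ℝ≥0∞ := fun j k t =>
    ∫⁻ x in ball (pt j k) (R j / 4), ‖fderiv ℝ (u t) x‖ₑ ^ 2 with hgdef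
  have hslice : ∀ t, ∫⁻ x in ball (0 : EuclideanSpace ℝ (Fin 3)) ρ, ‖fderiv ℝ (u t) x‖ₑ ^ 2 ≤
      (∑ k ∈ Good0, g 0 k t + ∑ j ∈ Finset.range J, ∑ k ∈ Next j, g (j + 1) k t) +
        ∑ k ∈ BadSet J, g J k t := by
    intro t
    refine (lintegral_mono_set (hcover J)).trans ?_
    refine (lintegral_union_le _ _ _).trans ?_
    refine (add_le_add (lintegral_union_le _ _ _) le_rfl).trans ?_
    refine add_le_add (add_le_add ?_ ?_) ?_
    · exact lintegral_biUnion_finset_le _ _ _ _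
    · exact (lintegral_biUnion_finset_le _ _ _ _).trans
        (Finset.sum_le_sum fun j _ => lintegral_biUnion_finset_le _ _ _ _)
    · exact lintegral_biUnion_finset_le _ _ _ _
  -- ### integrate in time (the ball dissipations are measurable in `t`)
  have hm : ∀ j k, AEMeasurable (g j k) (volume.restrict (Ioo a b)) := fun j k =>
    aemeasurable_setLIntegral_enorm_fderiv_sq hu ha0 hb (ball (pt j k) (R j / 4))
  have hint : ∫⁻ t in Ioo a b, ∫⁻ x in ball (0 : EuclideanSpace ℝ (Fin 3)) ρ, ‖fderiv ℝ (u t) x‖ₑ ^ 2 ≤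
      (∑ k ∈ Good0, (∫⁻ t in Ioo a b, g 0 k t) +
        ∑ j ∈ Finset.range J, ∑ k ∈ Next j, (∫⁻ t in Ioo a b, g (j + 1) k t)) +
        ∑ k ∈ BadSet J, (∫⁻ t in Ioo a b, g J k t) := by
    have hm1 : AEMeasurable (fun t => ∑ k ∈ Good0, g 0 k t) (volume.restrict (Ioo a b)) :=
      Finset.aemeasurable_fun_sum _ fun k _ => hm 0 k
    have hm2 : AEMeasurable (fun t => ∑ j ∈ Finset.range J, ∑ k ∈ Next j, g (j + 1) k t)
        (volume.restrict (Ioo a b)) :=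
      Finset.aemeasurable_fun_sum _ fun j _ => Finset.aemeasurable_fun_sum _ fun k _ => hm (j + 1) k
    have hm12 : AEMeasurable (fun t => ∑ k ∈ Good0, g 0 k t +
        ∑ j ∈ Finset.range J, ∑ k ∈ Next j, g (j + 1) k t) (volume.restrict (Ioo a b)) :=
      hm1.add hm2
    calc ∫⁻ t in Ioo a b, ∫⁻ x in ball (0 : EuclideanSpace ℝ (Fin 3)) ρ, ‖fderiv ℝ (u t) x‖ₑ ^ 2
        ≤ ∫⁻ t in Ioo a b, ((∑ k ∈ Good0, g 0 k t +
            ∑ j ∈ Finset.range J, ∑ k ∈ Next j, g (j + 1) k t) + ∑ k ∈ BadSet J, g J k t) :=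
          lintegral_mono fun t => hslice t
      _ = _ := by
        rw [lintegral_add_left' hm12, lintegral_add_left' hm1,
          lintegral_finsetSum' _ fun k _ => hm 0 k,
          lintegral_finsetSum' _ fun j _ => Finset.aemeasurable_fun_sum _ fun k _ => hm (j + 1) k,
          lintegral_finsetSum' _ fun k _ => hm J k]
        have e : ∀ j ∈ Finset.range J, ∫⁻ t in Ioo a b, ∑ k ∈ Next j, g (j + 1) k t =
            ∑ k ∈ Next j, (∫⁻ t in Ioo a b, g (j + 1) k t) := fun j _ =>
          lintegral_finsetSum' _ fun k _ => hm (j + 1) k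
        rw [Finset.sum_congr rfl e]
  -- ### certified balls: the smoothing envelope pays `C τ / R_j`
  have hgood : ∀ j, j ≤ J → ∀ k, ¬ bad j k →
      ∫⁻ t in Ioo a b, g j k t ≤ ENNReal.ofReal (C * (b - a) / R j) := by
    intro j hj k hk
    have hsmall : ∫⁻ y in ball (pt j k) (2 * R j), ‖u (b - σ * R j ^ 2) y‖ₑ ^ 3 ≤
        ENNReal.ofReal (γ ^ 3) := not_not.1 hk
    have ht₁ : a ∈ Ico (b - σ * R j ^ 2 / 4) b := ⟨by linarith only [hJ1' j hj], hab⟩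
    exact hS b (R j) (pt j k) (hRpos j) ((hRle j).trans hR₀r₀) (hrestart j).1 hb hsmall a ht₁
  -- ### bad balls of the last level: the scaled dissipation pays `M √(τ/σ')`
  have hbadJ : ∀ k, ∫⁻ t in Ioo a b, g J k t ≤ ENNReal.ofReal (M * Real.sqrt ((b - a) / σ')) := by
    intro k
    set R' : ℝ := Real.sqrt ((b - a) / σ') with hR'def
    have hR'pos : 0 < R' := Real.sqrt_pos.2 (div_pos hτpos hσ'pos)
    have hR'sq : R' ^ 2 = (b - a) / σ' := Real.sq_sqrt (div_pos hτpos hσ'pos).le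
    have hτR' : b - a ≤ R' ^ 2 := by
      rw [hR'sq, le_div_iff₀ hσ'pos]
      exact mul_le_of_le_one_right hτpos.le hσ'1
    have hRJ : R J / 4 ≤ R' := by
      have e : R₀ / 2 ^ (J + 1) = R J / 2 := hRsucc J
      rw [e] at hJ2
      have h1 : (R J / 4) ^ 2 * σ < b - a := by
        have e2 : (R J / 4) ^ 2 * σ = σ * (R J / 2) ^ 2 / 4 := by ring
        rw [e2]; exact hJ2
      have h2 : (R J / 4) ^ 2 < (b - a) / σ := (lt_div_iff₀ hσ).2 h1
      have h3 : (b - a) / σ ≤ (b - a) / σ' := div_le_div_of_nonneg_left hτpos.le hσ'pos hσ'σ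
      calc R J / 4 = Real.sqrt ((R J / 4) ^ 2) :=
            (Real.sqrt_sq (div_nonneg (hRpos J).le (by norm_num))).symm
        _ ≤ Real.sqrt ((b - a) / σ') := Real.sqrt_le_sqrt (h2.le.trans h3)
        _ = R' := hR'def.symm
    have hR'R₀ : R' ≤ R₀ / 4 := by
      have h1 : (b - a) / σ' ≤ (R₀ / 4) ^ 2 := by
        rw [div_le_iff₀ hσ'pos]
        have e2 : (R₀ / 4) ^ 2 * σ' = σ' * R₀ ^ 2 / 16 := by ring
        rw [e2]; exact hτ.trans hτ₀a
      calc R' = Real.sqrt ((b - a) / σ') := hR'def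
        _ ≤ Real.sqrt ((R₀ / 4) ^ 2) := Real.sqrt_le_sqrt h1
        _ = R₀ / 4 := Real.sqrt_sq (div_nonneg hR₀pos.le (by norm_num))
    have hR'r₀ : R' ≤ r₀ := by linarith only [hR'R₀, hR₀r₀, hR₀pos]
    have hR'b : R' ^ 2 ≤ b := by
      rw [hR'sq]
      have h1 : (b - a) / σ' ≤ T / 2 := by
        rw [div_le_iff₀ hσ'pos]
        have e2 : T / 2 * σ' = σ' * T / 2 := by ring
        rw [e2]; exact hτ.trans hτ₀b
      linarith only [h1, hb2]
    have h := hE b ⟨hbpos, hb⟩ (pt J k) R' ⟨hR'pos, hR'r₀⟩ hR'b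
    calc ∫⁻ t in Ioo a b, g J k t
        ≤ ∫⁻ t in Ioo a b, ∫⁻ y in ball (pt J k) R', ‖fderiv ℝ (u t) y‖ₑ ^ 2 :=
          lintegral_mono fun t => lintegral_mono_set (ball_subset_ball hRJ)
      _ ≤ ∫⁻ t in Ioo (b - R' ^ 2) b, ∫⁻ y in ball (pt J k) R', ‖fderiv ℝ (u t) y‖ₑ ^ 2 :=
          lintegral_mono_set (Ioo_subset_Ioo (by linarith only [hτR']) le_rfl)
      _ ≤ ENNReal.ofReal (M * R') := h
  -- ### cardinalities of the level sets
  have hcardGood0 : (Good0.card : ℝ) ≤ nstar := by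
    have h1 : Good0.card ≤ n₀ := Finset.card_filter_le _ _
    have h2 : (Good0.card : ℝ) ≤ n₀ := by exact_mod_cast h1
    have h3 : (0 : ℝ) ≤ 512000 * N₀ := mul_nonneg (by norm_num) (Nat.cast_nonneg _)
    linarith only [h2, h3]
  have hcardNext : ∀ j, ((Next j).card : ℝ) ≤ nstar := by
    intro j
    have h1 : (Next j).card ≤ ((BadSet j).biUnion children).card := Finset.card_filter_le _ _
    have h2 : ((BadSet j).biUnion children).card ≤ (BadSet j).card * 125 := by
      refine Finset.card_biUnion_le.trans ?_
      have := Finset.sum_le_card_nsmul (BadSet j) (fun k => (children k).card) 125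
        fun k _ => card_children_le k
      simpa using this
    have h3 : (BadSet j).card * 125 ≤ 4096 * N₀ * 125 := Nat.mul_le_mul_right _ (hcardBad j)
    have h4 : ((Next j).card : ℝ) ≤ 4096 * N₀ * 125 := by exact_mod_cast h1.trans (h2.trans h3)
    have h5 : (0 : ℝ) ≤ n₀ := Nat.cast_nonneg _
    linarith only [h4, h5]
  -- ### the three blocks in `ℝ≥0∞`
  have hB1 : ∑ k ∈ Good0, (∫⁻ t in Ioo a b, g 0 k t) ≤ ENNReal.ofReal (nstar * (C * (b - a) / R 0)) :=
    (Finset.sum_le_sum fun k hk => hgood 0 (Nat.zero_le _) k (Finset.mem_filter.1 hk).2).trans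
      (sum_const_ofReal_le _ (div_nonneg (mul_nonneg hC hτpos.le) (hRpos _).le) hcardGood0)
  have hB2 : ∀ j ∈ Finset.range J, ∑ k ∈ Next j, (∫⁻ t in Ioo a b, g (j + 1) k t) ≤
      ENNReal.ofReal (nstar * (C * (b - a) / R (j + 1))) := fun j hj =>
    (Finset.sum_le_sum fun k hk => hgood (j + 1) (Finset.mem_range.1 hj) k
      (Finset.mem_filter.1 hk).2).trans
      (sum_const_ofReal_le _ (div_nonneg (mul_nonneg hC hτpos.le) (hRpos _).le) (hcardNext j))
  have hB3 : ∑ k ∈ BadSet J, (∫⁻ t in Ioo a b, g J k t) ≤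
      ENNReal.ofReal ((4096 * N₀ : ℝ) * (M * Real.sqrt ((b - a) / σ'))) :=
    (Finset.sum_le_sum fun k _ => hbadJ k).trans
      (sum_const_ofReal_le _ (mul_nonneg hM (Real.sqrt_nonneg _)) (by exact_mod_cast hcardBad J))
  -- ### add up
  have hreal := sieve_arith (R₀ := R₀) (σ' := σ') (C := C) (M := M) (nstar := nstar)
    (N := (4096 * N₀ : ℝ)) J hR₀pos hσ hσ'pos hτpos hC hnstar0 hJ1
  calc ∫⁻ t in Ioo a b, ∫⁻ x in ball (0 : EuclideanSpace ℝ (Fin 3)) ρ, ‖fderiv ℝ (u t) x‖ₑ ^ 2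
      ≤ (∑ k ∈ Good0, (∫⁻ t in Ioo a b, g 0 k t) +
          ∑ j ∈ Finset.range J, ∑ k ∈ Next j, (∫⁻ t in Ioo a b, g (j + 1) k t)) +
          ∑ k ∈ BadSet J, (∫⁻ t in Ioo a b, g J k t) := hint
    _ ≤ (ENNReal.ofReal (nstar * (C * (b - a) / R 0)) +
          ∑ j ∈ Finset.range J, ENNReal.ofReal (nstar * (C * (b - a) / R (j + 1)))) +
          ENNReal.ofReal ((4096 * N₀ : ℝ) * (M * Real.sqrt ((b - a) / σ'))) :=
        add_le_add (add_le_add hB1 (Finset.sum_le_sum hB2)) hB3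
    _ = ENNReal.ofReal (nstar * (C * (b - a) / R 0) +
          ∑ j ∈ Finset.range J, nstar * (C * (b - a) / R (j + 1)) +
          (4096 * N₀ : ℝ) * (M * Real.sqrt ((b - a) / σ'))) := by
        have h4 : ∀ j ∈ Finset.range J, 0 ≤ nstar * (C * (b - a) / R (j + 1)) :=
          fun j _ => mul_nonneg hnstar0 (div_nonneg (mul_nonneg hC hτpos.le) (hRpos _).le)
        have h1 : 0 ≤ nstar * (C * (b - a) / R 0) :=
          mul_nonneg hnstar0 (div_nonneg (mul_nonneg hC hτpos.le) (hRpos _).le)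
        have h2 : 0 ≤ ∑ j ∈ Finset.range J, nstar * (C * (b - a) / R (j + 1)) :=
          Finset.sum_nonneg h4
        have h3 : (0 : ℝ) ≤ (4096 * N₀ : ℝ) * (M * Real.sqrt ((b - a) / σ')) :=
          mul_nonneg (mul_nonneg (by norm_num) (Nat.cast_nonneg _)) (mul_nonneg hM (Real.sqrt_nonneg _))
        rw [ENNReal.ofReal_add (add_nonneg h1 h2) h3, ENNReal.ofReal_add h1 h2,
          ENNReal.ofReal_sum_of_nonneg h4]
    _ ≤ ENNReal.ofReal (K * Real.sqrt (b - a)) := ENNReal.ofReal_le_ofReal hreal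

end Summit.NavierStokesRegularity.NavierStokesRegularity.Theorems.EnstrophyQuarterLaw.SparseSieve

end
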